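import Mathlib
import Summits.Ventures.PercRepro2.Defs
import Summits.Ventures.PercRepro2.Independence
import Summits.Ventures.PercRepro2.Harris
import Summits.Ventures.PercRepro2.ZCTwoEdge
import Summits.Ventures.PercRepro2.ZCA3WCert
import Summits.Ventures.PercRepro2.ZCA3WTypes
import Summits.Ventures.PercRepro2.ZCA3WCells

/-!
# Theorem E (MINE-A.md §70.7), abstract form — (ZC) when `a₃` has degree two with neighbours `a₁`
and a non-mark `w`, from (ZC) on `G − a₃` for the marks `(a₁, w, o)`
(blind cell PercRepro2, mine-a g24)

Abstract setting: two distinct edges `f₁` (weight `p f₁`), `f₂` (weight `p f₂`) and six events of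
the configuration space that ignore `f₁`, `f₂` — in the graph instance (`ZCA3WGraph.lean`) they are
the events of `G − a₃`: `A = {a₁ ↔ o}`, `W = {a₁ ↔ w}`, `Γ = {w ↔ o}`, `X₀ = {C(a₁) ∈ 𝒰}`,
`X₁ = {C(a₁) ∪ {a₃} ∈ 𝒰}`, `X₂ = {C(a₁) ∪ C(w) ∪ {a₃} ∈ 𝒰}`.  The five types of `(a₁, o, w)` are
`T₁ = A ∩ W`, `T₂ = A ∩ Wᶜ`, `T₃ = Aᶜ ∩ W`, `T₄ = Aᶜ ∩ Wᶜ ∩ Γ`, `T₅ = Aᶜ ∩ Wᶜ ∩ Γᶜ`, and the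
four (ZC) events are `e = {f₁ open} ∪ ({f₂ open} ∩ W)`, `L = A ∪ ({f₁, f₂ open} ∩ Γ)`,
`γ = ({f₁ open} ∩ A) ∪ ({f₂ open} ∩ Γ)`, `U = ({f₁, f₂ open} ∩ X₂) ∪ (e ∩ {f₁, f₂ open}ᶜ ∩ X₁) ∪ (eᶜ ∩ X₀)`.

**Theorem** (`zc_a3w`): with `A, W, Γ, X₀, X₁, X₂` increasing, `W ∩ Γ ⊆ A`, `X₀ ⊆ X₁ ⊆ X₂`,
`X₁ ∩ W = X₂ ∩ W`, lemma (P1) `P(T₃) P(T₄) ≤ P(T₁) P(T₅)` and the inductive hypothesis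
`(ZC)(W, A, Γ; X₁) ≥ 0` (= (ZC) on `G − a₃` for the marks `(a₁, w, o)` and the up-set shifted by `a₃`),
(ZC) `P(D) Cov(U, eL) − P(B) Cov(U, e¬L) ≥ 0`.  Proof: expand the seven probabilities over the four
states of `(f₁, f₂)` (`prob_two_pin`) into the type masses `mτk = P(Xₖ ∩ Tτ)`, derive the nine Harris
slacks from `prob_mul_prob_le_prob_inter`, and apply the kernel certificate `zc_a3w_cert`.  One seat.
-/

namespace Summit.Ventures.PercRepro2

section TheoremEAbstract

variable {E : Type*} [Fintype E] [DecidableEq E] {R : Type*} [CommRing R] [LinearOrder R]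
  [IsStrictOrderedRing R]

/-- **Theorem E, abstract form** — see the module docstring. -/
theorem zc_a3w {p : E → R} (hp : IsProbVec p) {f₁ f₂ : E} (hf : f₁ ≠ f₂)
    {A W Γ X₀ X₁ X₂ : Set (Config E)}
    (hA : ∀ (ω : Config E) (b₁ b₂ : Bool),
      Function.update (Function.update ω f₁ b₁) f₂ b₂ ∈ A ↔ ω ∈ A)
    (hW : ∀ (ω : Config E) (b₁ b₂ : Bool),
      Function.update (Function.update ω f₁ b₁) f₂ b₂ ∈ W ↔ ω ∈ W)
    (hΓ : ∀ (ω : Config E) (b₁ b₂ : Bool),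
      Function.update (Function.update ω f₁ b₁) f₂ b₂ ∈ Γ ↔ ω ∈ Γ)
    (hX₀ : ∀ (ω : Config E) (b₁ b₂ : Bool),
      Function.update (Function.update ω f₁ b₁) f₂ b₂ ∈ X₀ ↔ ω ∈ X₀)
    (hX₁ : ∀ (ω : Config E) (b₁ b₂ : Bool),
      Function.update (Function.update ω f₁ b₁) f₂ b₂ ∈ X₁ ↔ ω ∈ X₁)
    (hX₂ : ∀ (ω : Config E) (b₁ b₂ : Bool),
      Function.update (Function.update ω f₁ b₁) f₂ b₂ ∈ X₂ ↔ ω ∈ X₂)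
    (hAup : IsUpperSet A) (hWup : IsUpperSet W) (hΓup : IsUpperSet Γ)
    (hX₀up : IsUpperSet X₀) (hX₁up : IsUpperSet X₁) (hX₂up : IsUpperSet X₂)
    (hWΓ : ∀ ω, ω ∈ W → ω ∈ Γ → ω ∈ A) (hAW : ∀ ω, ω ∈ A → ω ∈ W → ω ∈ Γ)
    (hAΓ : ∀ ω, ω ∈ A → ω ∈ Γ → ω ∈ W)
    (h01 : X₀ ⊆ X₁) (h12 : X₁ ⊆ X₂) (h12W : X₁ ∩ W = X₂ ∩ W)
    (hP1 : prob p (Aᶜ ∩ W) * prob p (Aᶜ ∩ Wᶜ ∩ Γ) ≤ prob p (A ∩ W) * prob p (Aᶜ ∩ Wᶜ ∩ Γᶜ))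
    (hZC : 0 ≤ prob p (Wᶜ ∩ Aᶜ ∩ Γᶜ) * (prob p (X₁ ∩ (W ∩ A)) - prob p X₁ * prob p (W ∩ A))
      - prob p (Wᶜ ∩ Aᶜ ∩ Γ) * (prob p (X₁ ∩ (W ∩ Aᶜ)) - prob p X₁ * prob p (W ∩ Aᶜ))) :
    let e := openEdge f₁ ∪ (openEdge f₂ ∩ W)
    let L := A ∪ (openEdge f₁ ∩ openEdge f₂ ∩ Γ)
    let U := (openEdge f₁ ∩ openEdge f₂ ∩ X₂) ∪ (e ∩ (openEdge f₁ ∩ openEdge f₂)ᶜ ∩ X₁)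
      ∪ (eᶜ ∩ X₀)
    let γ := (openEdge f₁ ∩ A) ∪ (openEdge f₂ ∩ Γ)
    0 ≤ prob p (eᶜ ∩ Lᶜ ∩ γᶜ) * (prob p (U ∩ (e ∩ L)) - prob p U * prob p (e ∩ L))
      - prob p (eᶜ ∩ Lᶜ ∩ γ) * (prob p (U ∩ (e ∩ Lᶜ)) - prob p U * prob p (e ∩ Lᶜ)) := by
  intro e L U γ
  -- the cell expansions
  have PeL := a3w_prob_eL p hf hA hW hΓ
  have PenL := a3w_prob_enL p hf hA hW hΓ
  have PUeL := a3w_prob_UeL p hf hA hW hΓ hX₀ hX₁ hX₂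
  have PUenL := a3w_prob_UenL p hf hA hW hΓ hX₀ hX₁ hX₂
  have PU := a3w_prob_U p hf hW hX₀ hX₁ hX₂
  have PB := a3w_prob_B p hf hA hW hΓ
  have PD := a3w_prob_D p hf hA hW hΓ
  -- the coincidences `m12 = m11`, `m32 = m31`
  have hm12 : prob p (X₂ ∩ (A ∩ W)) = prob p (X₁ ∩ (A ∩ W)) := by
    rw [← Set.inter_assoc, ← Set.inter_assoc, Set.inter_comm X₂ A, Set.inter_comm X₁ A,
      Set.inter_assoc, Set.inter_assoc, h12W]
  have hm32 : prob p (X₂ ∩ (Aᶜ ∩ W)) = prob p (X₁ ∩ (Aᶜ ∩ W)) := by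
    rw [← Set.inter_assoc, ← Set.inter_assoc, Set.inter_comm X₂ Aᶜ, Set.inter_comm X₁ Aᶜ,
      Set.inter_assoc, Set.inter_assoc, h12W]
  -- type probabilities of the events in the cells
  have hsum := prob_eq_sum_five p A W Γ Set.univ
  simp only [Set.univ_inter, prob_univ] at hsum
  have PAΓ := prob_inter_union_AΓ p hWΓ Set.univ
  have PA := prob_inter_A p (A := A) (W := W) Set.univ
  have PAΓc := prob_inter_compl_union_AΓ p hWΓ Set.univ
  have PAc := prob_inter_Ac p (A := A) (W := W) (Γ := Γ) Set.univ
  have PAW := prob_inter_union_AW p (A := A) (W := W) Set.univ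
  have PW := prob_inter_W p (A := A) (W := W) Set.univ
  have PΓ := prob_inter_Γ p hWΓ hAW hAΓ Set.univ
  simp only [Set.univ_inter] at PAΓ PA PAΓc PAc PAW PW PΓ
  have PWA : prob p (W ∩ A) = prob p (A ∩ W) := by rw [Set.inter_comm]
  have PWAc : prob p (W ∩ Aᶜ) = prob p (Aᶜ ∩ W) := by rw [Set.inter_comm]
  -- masses of the cluster events against the cell events
  have MX2AΓ := prob_inter_union_AΓ p hWΓ X₂
  rw [hm12] at MX2AΓ
  have MX2AΓc := prob_inter_compl_union_AΓ p hWΓ X₂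
  rw [hm32] at MX2AΓc
  have MX1A := prob_inter_A p (A := A) (W := W) X₁
  have MX1Ac := prob_inter_Ac p (A := A) (W := W) (Γ := Γ) X₁
  have MX0 := prob_eq_sum_five p A W Γ X₀
  have MX1 := prob_eq_sum_five p A W Γ X₁
  have MX2 := prob_eq_sum_five p A W Γ X₂
  rw [hm12, hm32] at MX2
  have Mmix := prob_mix p (A := A) (W := W) (Γ := Γ) X₀ X₁
  have MX0AW := prob_inter_union_AW p (A := A) (W := W) X₀
  have MX0A := prob_inter_A p (A := A) (W := W) X₀
  have MX1AΓ := prob_inter_union_AΓ p hWΓ X₁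
  have MX1W := prob_inter_W p (A := A) (W := W) X₁
  have MX2Γ := prob_inter_Γ p hWΓ hAW hAΓ X₂
  rw [hm12] at MX2Γ
  have MX2A := prob_inter_A p (A := A) (W := W) X₂
  rw [hm12] at MX2A
  have MX1WA : prob p (X₁ ∩ (W ∩ A)) = prob p (X₁ ∩ (A ∩ W)) := by rw [Set.inter_comm W A]
  have MX1WAc : prob p (X₁ ∩ (W ∩ Aᶜ)) = prob p (X₁ ∩ (Aᶜ ∩ W)) := by rw [Set.inter_comm W Aᶜ]
  -- Harris slacks (with `P(S) P(X)` in the certificate's order)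
  have hT1up : IsUpperSet (A ∩ W) := hAup.inter hWup
  have hAWup : IsUpperSet (A ∪ W) := hAup.union hWup
  have hAΓup : IsUpperSet (A ∪ Γ) := hAup.union hΓup
  have har : ∀ {X S : Set (Config E)}, IsUpperSet X → IsUpperSet S →
      0 ≤ prob p (X ∩ S) - prob p S * prob p X := fun hX hS => by
    rw [mul_comm]; exact sub_nonneg.2 (prob_mul_prob_le_prob_inter hp hX hS)
  have hHar0_1 := har hX₀up hT1up
  have hHar0_12 := har hX₀up hAup
  have hHar0_123 := har hX₀up hAWup
  have hHar1_1 := har hX₁up hT1up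
  have hHar1_12 := har hX₁up hAup
  have hHar1_13 := har hX₁up hWup
  have hHar1_124 := har hX₁up hAΓup
  have hHar2_1 := har hX₂up hT1up
  have hHar2_12 := har hX₂up hAup
  have hHar2_14 := har hX₂up hΓup
  have hHar2_124 := har hX₂up hAΓup
  rw [MX0] at hHar0_1 hHar0_12 hHar0_123
  rw [MX0A, PA] at hHar0_12
  rw [MX0AW, PAW] at hHar0_123
  rw [MX1] at hHar1_1 hHar1_12 hHar1_13 hHar1_124
  rw [MX1A, PA] at hHar1_12
  rw [MX1W, PW] at hHar1_13
  rw [MX1AΓ, PAΓ] at hHar1_124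
  rw [MX2] at hHar2_1 hHar2_12 hHar2_14 hHar2_124
  rw [hm12] at hHar2_1
  rw [MX2A, PA] at hHar2_12
  rw [MX2Γ, PΓ] at hHar2_14
  rw [MX2AΓ, PAΓ] at hHar2_124
  -- monotonicity slacks
  have mono : ∀ {X Y : Set (Config E)} (T : Set (Config E)), X ⊆ Y →
      0 ≤ prob p (Y ∩ T) - prob p (X ∩ T) :=
    fun T h => sub_nonneg.2 (prob_mono hp (Set.inter_subset_inter_left _ h))
  have hm11_m10 := mono (A ∩ W) h01
  have hm21_m20 := mono (A ∩ Wᶜ) h01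
  have hm22_m21 := mono (A ∩ Wᶜ) h12
  have hm31_m30 := mono (Aᶜ ∩ W) h01
  have hm41_m40 := mono (Aᶜ ∩ Wᶜ ∩ Γ) h01
  have hm42_m41 := mono (Aᶜ ∩ Wᶜ ∩ Γ) h12
  have hm51_m50 := mono (Aᶜ ∩ Wᶜ ∩ Γᶜ) h01
  have hm52_m51 := mono (Aᶜ ∩ Wᶜ ∩ Γᶜ) h12
  -- (P1) and the inductive atom in the type vocabulary
  have hP1' := sub_nonneg.2 hP1
  have hT5' : Wᶜ ∩ Aᶜ ∩ Γᶜ = Aᶜ ∩ Wᶜ ∩ Γᶜ := by rw [Set.inter_comm Wᶜ Aᶜ]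
  have hT4' : Wᶜ ∩ Aᶜ ∩ Γ = Aᶜ ∩ Wᶜ ∩ Γ := by rw [Set.inter_comm Wᶜ Aᶜ]
  rw [hT5', hT4', MX1WA, MX1WAc, PWA, PWAc, MX1] at hZC
  -- the weights
  have hp0 := hp.nonneg f₁
  have hp1 : 0 ≤ 1 - p f₁ := sub_nonneg.2 (hp.le_one f₁)
  have hq0 := hp.nonneg f₂
  have hq1 : 0 ≤ 1 - p f₂ := sub_nonneg.2 (hp.le_one f₂)
  have hT1 : 0 ≤ prob p (A ∩ W) := prob_nonneg hp _
  have hT2 : 0 ≤ prob p (A ∩ Wᶜ) := prob_nonneg hp _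
  have hT3 : 0 ≤ prob p (Aᶜ ∩ W) := prob_nonneg hp _
  have hT4 : 0 ≤ prob p (Aᶜ ∩ Wᶜ ∩ Γ) := prob_nonneg hp _
  have hT5 : 0 ≤ prob p (Aᶜ ∩ Wᶜ ∩ Γᶜ) := prob_nonneg hp _
  -- rewrite the goal into the masses
  rw [PeL, PUeL, PenL, PUenL, PU, PB, PD, PAΓ, PA, PWA, PAΓc, PAc, PWAc, MX2AΓ, MX1A,
    MX2AΓc, MX1Ac, MX2, MX1, Mmix, MX0]
  -- the certificate
  have key := zc_a3w_cert (p f₁) (p f₂) (prob p (A ∩ W)) (prob p (A ∩ Wᶜ)) (prob p (Aᶜ ∩ W))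
    (prob p (Aᶜ ∩ Wᶜ ∩ Γ)) (prob p (Aᶜ ∩ Wᶜ ∩ Γᶜ))
    (prob p (X₀ ∩ (A ∩ W))) (prob p (X₁ ∩ (A ∩ W))) (prob p (X₀ ∩ (A ∩ Wᶜ))) (prob p (X₁ ∩ (A ∩ Wᶜ)))
    (prob p (X₂ ∩ (A ∩ Wᶜ))) (prob p (X₀ ∩ (Aᶜ ∩ W))) (prob p (X₁ ∩ (Aᶜ ∩ W)))
    (prob p (X₀ ∩ (Aᶜ ∩ Wᶜ ∩ Γ))) (prob p (X₁ ∩ (Aᶜ ∩ Wᶜ ∩ Γ))) (prob p (X₂ ∩ (Aᶜ ∩ Wᶜ ∩ Γ)))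
    (prob p (X₀ ∩ (Aᶜ ∩ Wᶜ ∩ Γᶜ))) (prob p (X₁ ∩ (Aᶜ ∩ Wᶜ ∩ Γᶜ))) (prob p (X₂ ∩ (Aᶜ ∩ Wᶜ ∩ Γᶜ)))
    hp0 hp1 hq0 hq1 hT1 hT2 hT3 hT4 hT5 hsum.symm hm11_m10 hm21_m20 hm22_m21 hm31_m30
    hm41_m40 hm42_m41 hm51_m50 hm52_m51 hHar0_1 hHar0_12 hHar0_123 hHar1_1 hHar1_12 hHar1_13
    hHar1_124 hHar2_1 hHar2_12 hHar2_14 hHar2_124 hP1' hZC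
  refine le_of_le_of_eq key ?_
  ring

end TheoremEAbstract

end Summit.Ventures.PercRepro2
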